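import Literature.Analysis.Calculus.ExteriorSobolev
import Literature.Geometry.Lorentzian.EndFluxFormula
import Literature.Geometry.Lorentzian.RicciDecay
import HarnessLib

/-!
# The Sobolev inequality on the end of an asymptotically flat manifold
# (Schoen–Yau 1979, proof of Lemma 3.1: the inequality on `N_k`)

Schoen–Yau, Comm. Math. Phys. 65 (1979), Lemma 3.1 (p. 63): *"Since `N_k` is identified with
`ℝ³ ∖ B_{σ₀}(0)` and `ds²` is uniformly equivalent to the Euclidean metric, we have the inequality
which follows from the Euclidean inequality `(∫_{N_k} ζ⁶)^{1/3} ≤ const ∫_{N_k} ‖Dζ‖²`"* for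
functions `ζ` with compact support on `N`. This file proves the version used to assemble
Lemma 3.1 in this tree: for data `(h, k)` on a `3`-manifold `X` with an end `e` on which
`h − δ = O₂(r^{−α})`, `α > 0`, there are a radius `s > R` and a constant `C` such that for every
`ζ ∈ C¹_c(X)` the truncation to the end `ζ₁ = (1 − χ_s ∘ coord) ζ` (`χ_s` the cut-off
`Literature.Analysis.FluidPDE.cutoff s`, so `ζ₁ = 0` where `‖coord‖ ≤ s` and `ζ₁ = ζ` where
`2s ≤ ‖coord‖`) satisfies

  `∫_X ζ₁⁶ dV_h ≤ C (∫_X h⁻¹(dζ, dζ) dV_h)³`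

(`AFEnd.integral_endTruncation_pow_six_le`). Ingredients: the Euclidean estimate for the
truncation (`eLpNorm_six_cutoff_mul_le`, `ExteriorSobolev.lean`: Hardy + Gagliardo–Nirenberg–
Sobolev), the chart formulas for integrals over the end and for `h⁻¹(du, dv)`
(`EndChartIntegral.lean`), the bounds `√(det h_{ij}) ≤ 7` (`RicciDecay.lean`) and
`(h_{ij})⁻¹ √(det h_{ij}) → δ` (`EndFluxEstimates.lean`), which make `ds²` "uniformly equivalent
to the Euclidean metric" far out: `‖Du‖² ≤ 2 h⁻¹(dζ, dζ) √(det h_{ij})` with `u = ζ ∘ Φ`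
(`quadForm_ge_half_sum_sq`, `norm_sq_le_sum_sq_apply`). Auxiliary: a compactly supported
function vanishes far out in the chart (`AFEnd.exists_radius_endValue_eq_zero`), smoothness of
`χ_s ∘ coord` (`AFEnd.contMDiff_cutoff_coord`). All results proved; no named facts.

## References

* R. Schoen, S.-T. Yau, *On the proof of the positive mass conjecture in general relativity*,
  Comm. Math. Phys. 65 (1979) 45–76, Lemma 3.1 and its proof (pp. 63–64).
-/

noncomputable section

open Set Function Filter Metric MeasureTheory Measure TopologicalSpace Bornology Asymptotics Manifold
  Bundle Module
open scoped Topology Manifold ContDiff ENNReal NNReal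

namespace Literature.Geometry.Lorentzian

open Literature.Analysis.FluidPDE Literature.Analysis.Calculus

/-! ### Linear algebra in `ℝ³` -/

/-- **A quadratic form close to the identity is bounded below**: if `|W_{kl} − δ_{kl}| ≤ 1/6`
on `Fin 3` then `∑ₗ ∑ₖ W_{kl} aₖ aₗ ≥ ½ ∑ₖ aₖ²` (the error is at most `(1/6)(∑|aₖ|)² ≤ ½ ∑ aₖ²`).
[folklore] -/
theorem quadForm_ge_half_sum_sq {W : Matrix (Fin 3) (Fin 3) ℝ}
    (hW : ∀ k l, |W k l - (1 : Matrix (Fin 3) (Fin 3) ℝ) k l| ≤ 1 / 6) (a : Fin 3 → ℝ) :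
    (1 / 2) * ∑ k, a k ^ 2 ≤ ∑ l, ∑ k, W k l * a k * a l := by
  have hδ : ∑ l, ∑ k, (1 : Matrix (Fin 3) (Fin 3) ℝ) k l * a k * a l = ∑ k, a k ^ 2 := by
    rw [Finset.sum_comm]
    refine Finset.sum_congr rfl fun k _ ↦ ?_
    simp only [Matrix.one_apply, ite_mul, one_mul, zero_mul, Finset.sum_ite_eq, Finset.mem_univ,
      if_true, sq]
  have hsplit : ∑ l, ∑ k, W k l * a k * a l =
      ∑ k, a k ^ 2 + ∑ l, ∑ k, (W k l - (1 : Matrix (Fin 3) (Fin 3) ℝ) k l) * a k * a l := by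
    rw [← hδ, ← Finset.sum_add_distrib]
    refine Finset.sum_congr rfl fun l _ ↦ ?_
    rw [← Finset.sum_add_distrib]
    refine Finset.sum_congr rfl fun k _ ↦ ?_
    ring
  have herr : |∑ l, ∑ k, (W k l - (1 : Matrix (Fin 3) (Fin 3) ℝ) k l) * a k * a l| ≤
      (1 / 6) * (∑ k, |a k|) ^ 2 := by
    calc |∑ l, ∑ k, (W k l - (1 : Matrix (Fin 3) (Fin 3) ℝ) k l) * a k * a l|
        ≤ ∑ l, ∑ k, |(W k l - (1 : Matrix (Fin 3) (Fin 3) ℝ) k l) * a k * a l| :=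
          (Finset.abs_sum_le_sum_abs _ _).trans (Finset.sum_le_sum fun l _ ↦ Finset.abs_sum_le_sum_abs _ _)
      _ ≤ ∑ l, ∑ k, (1 / 6) * (|a k| * |a l|) := by
          refine Finset.sum_le_sum fun l _ ↦ Finset.sum_le_sum fun k _ ↦ ?_
          rw [abs_mul, abs_mul, mul_assoc]
          exact mul_le_mul_of_nonneg_right (hW k l) (by positivity)
      _ = (1 / 6) * (∑ k, |a k|) ^ 2 := by
          rw [sq, Finset.sum_mul_sum, Finset.mul_sum, Finset.sum_comm]
          refine Finset.sum_congr rfl fun l _ ↦ ?_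
          rw [Finset.mul_sum]
  have hcs : (∑ k, |a k|) ^ 2 ≤ 3 * ∑ k, a k ^ 2 := by
    have h := sq_sum_le_card_mul_sum_sq (s := Finset.univ) (f := fun k : Fin 3 ↦ |a k|)
    simp only [Finset.card_univ, Fintype.card_fin, sq_abs] at h
    exact_mod_cast h
  rw [hsplit]
  have h1 := neg_abs_le (∑ l, ∑ k, (W k l - (1 : Matrix (Fin 3) (Fin 3) ℝ) k l) * a k * a l)
  nlinarith [Finset.sum_nonneg (fun k (_ : k ∈ Finset.univ) ↦ sq_nonneg (a k))]

/-- **The operator norm of a covector on `ℝ³` is at most the `ℓ²`-norm of its components**: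
`‖f‖² ≤ ∑ₖ f(eₖ)²` (Cauchy–Schwarz after expanding `ξ = ∑ ξₖ eₖ`). [folklore] -/
theorem norm_sq_le_sum_sq_apply (f : E3 →L[ℝ] ℝ) :
    ‖f‖ ^ 2 ≤ ∑ k, (f (EuclideanSpace.single k 1)) ^ 2 := by
  have hS : 0 ≤ ∑ k, (f (EuclideanSpace.single k 1)) ^ 2 := Finset.sum_nonneg fun _ _ ↦ sq_nonneg _
  have hbound : ‖f‖ ≤ Real.sqrt (∑ k, (f (EuclideanSpace.single k 1)) ^ 2) := by
    refine ContinuousLinearMap.opNorm_le_bound _ (Real.sqrt_nonneg _) fun ξ ↦ ?_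
    have hexp : f ξ = ∑ k, ξ k * f (EuclideanSpace.single k 1) := by
      conv_lhs => rw [← (EuclideanSpace.basisFun (Fin 3) ℝ).sum_repr' ξ]
      simp only [_root_.map_sum, map_smul, smul_eq_mul, EuclideanSpace.basisFun_apply,
        EuclideanSpace.inner_single_left, map_one, one_mul]
    rw [hexp, Real.norm_eq_abs]
    have hcs := Finset.sum_mul_sq_le_sq_mul_sq Finset.univ (fun k ↦ ξ k)
      (fun k ↦ f (EuclideanSpace.single k 1))
    have hξ : ∑ k, ξ k ^ 2 = ‖ξ‖ ^ 2 := (EuclideanSpace.real_norm_sq_eq ξ).symm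
    rw [hξ] at hcs
    have h2 : |∑ k, ξ k * f (EuclideanSpace.single k 1)| ^ 2 ≤
        (Real.sqrt (∑ k, (f (EuclideanSpace.single k 1)) ^ 2) * ‖ξ‖) ^ 2 := by
      rw [sq_abs, mul_pow, Real.sq_sqrt hS, mul_comm]
      exact hcs
    exact abs_le_of_sq_le_sq' h2 (by positivity) |>.2
  nlinarith [Real.sq_sqrt hS, norm_nonneg f, Real.sqrt_nonneg (∑ k, (f (EuclideanSpace.single k 1)) ^ 2)]

namespace AFEnd

variable {X : Type} [TopologicalSpace X] [ChartedSpace E3 X] (e : AFEnd X)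

/-! ### Compactly supported functions and cut-offs in the chart of the end -/

/-- **A compactly supported function vanishes far out in the chart of the end**: if `ζ` has
compact support then `ζ(Φ y) = 0` for `‖y‖` large (`Φ = e.dataChart`; the part of `tsupport ζ`
in the closed far piece `{R + 1 ≤ ‖coord‖}` is compact, hence has bounded image under the
continuous coordinate map). [folklore] -/
theorem exists_radius_endValue_eq_zero {ζ : X → ℝ} (hζ : HasCompactSupport ζ) :
    ∃ ρ : ℝ, ∀ y : E3, ρ ≤ ‖y‖ → endValue e ζ y = 0 := by
  set S : Set X := ((↑) : e.U → X) '' (e.chart ⁻¹' {x | e.R + 1 ≤ ‖(x : E3)‖}) with hS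
  have hSc : IsClosed S := e.isClosed_far (e.R + 1) (by linarith)
  have hTc : IsCompact (tsupport ζ ∩ S) := hζ.inter_right hSc
  have hSU : S ⊆ (e.U : Set X) := by
    rintro _ ⟨u, -, rfl⟩
    exact u.2
  have hcont : ContinuousOn e.coord (e.U : Set X) := fun q hq ↦
    (e.contMDiffAt_coord hq).continuousAt.continuousWithinAt
  have himg : IsCompact (e.coord '' (tsupport ζ ∩ S)) :=
    hTc.image_of_continuousOn (hcont.mono (inter_subset_right.trans hSU))
  obtain ⟨C, hC⟩ := himg.isBounded.exists_norm_le
  refine ⟨max C (e.R + 1) + 1, fun y hy ↦ ?_⟩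
  have hyR : e.R < ‖y‖ := by
    have := le_max_right C (e.R + 1)
    linarith
  rw [endValue_of_lt e ζ hyR]
  by_contra hne
  set q : X := e.dataChart ⟨y, hyR⟩ with hq
  have hqU : q ∈ e.U := (e.chart.symm ⟨y, hyR⟩).2
  have hcoord : e.coord q = y := e.coord_dataChart ⟨y, hyR⟩
  have hqT : q ∈ tsupport ζ := subset_tsupport _ (mem_support.2 hne)
  have hqS : q ∈ S := by
    refine ⟨⟨q, hqU⟩, ?_, rfl⟩
    change e.R + 1 ≤ ‖(e.chart ⟨q, hqU⟩ : E3)‖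
    rw [← e.coord_of_mem hqU, hcoord]
    have := le_max_right C (e.R + 1)
    linarith
  have hle := hC y ⟨q, ⟨hqT, hqS⟩, hcoord⟩
  have := le_max_left C (e.R + 1)
  linarith

/-- Off the end, `coord` is the junk value `0`. [folklore] -/
private theorem coord_of_not_mem'' {q : X} (hq : q ∉ e.U) : e.coord q = 0 := by
  classical
  exact dif_neg hq

/-- The closed far piece `{q ∈ U | s ≤ ‖coord q‖}` through `coord`. [folklore] -/
private theorem mem_closedFar_iff' {s : ℝ} {q : X} :
    q ∈ ((↑) : e.U → X) '' (e.chart ⁻¹' {x | s ≤ ‖(x : E3)‖}) ↔ ∃ _ : q ∈ e.U, s ≤ ‖e.coord q‖ := by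
  constructor
  · rintro ⟨u, hu, rfl⟩
    refine ⟨u.2, ?_⟩
    rw [e.coord_of_mem u.2]
    simpa using hu
  · rintro ⟨hq, hR⟩
    refine ⟨⟨q, hq⟩, ?_, rfl⟩
    rw [e.coord_of_mem hq] at hR
    simpa using hR

/-- **The cut-off `χ_s ∘ coord` is smooth on `X`** (`s > R`): on the end it is the smooth cut-off
of the smooth coordinate map, and off the closed far piece `{s ≤ ‖coord‖}` it is identically `1`
(`χ_s = 1` on the ball of radius `s`, and `coord = 0` off the end). [folklore] -/
theorem contMDiff_cutoff_coord {s : ℝ} (hs : e.R < s) :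
    ContMDiff (𝓡 3) 𝓘(ℝ, ℝ) ∞ fun q ↦ cutoff s (e.coord q) := fun q ↦ by
  have hs0 : 0 < s := e.R_pos.trans hs
  by_cases hq : q ∈ ((↑) : e.U → X) '' (e.chart ⁻¹' {x | s ≤ ‖(x : E3)‖})
  · obtain ⟨hqU, -⟩ := e.mem_closedFar_iff'.1 hq
    exact (contDiff_cutoff (n := ⊤) s).contDiffAt.comp_contMDiffAt (e.contMDiffAt_coord hqU)
  · have hev : (fun q ↦ cutoff s (e.coord q)) =ᶠ[𝓝 q] fun _ ↦ 1 := by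
      refine Filter.eventuallyEq_of_mem ((e.isClosed_far s hs).isOpen_compl.mem_nhds hq)
        fun p hp ↦ cutoff_eq_one hs0 ?_
      rw [mem_compl_iff, e.mem_closedFar_iff', not_exists] at hp
      by_cases hpU : p ∈ e.U
      · exact le_of_lt (not_le.1 (hp hpU))
      · rw [e.coord_of_not_mem'' hpU, norm_zero]
        exact hs0.le
    exact contMDiffAt_const.congr_of_eventuallyEq hev

/-- The truncation `(1 − χ_s ∘ coord) ζ` is supported in the far region `far s` (`s > 0`):
where it is nonzero, `‖coord‖ > s`. [folklore] -/
theorem support_endTruncation_subset {s : ℝ} (hs : 0 < s) (ζ : X → ℝ) :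
    support (fun q ↦ (1 - cutoff s (e.coord q)) * ζ q) ⊆ e.far s := by
  intro q hq
  rw [mem_support] at hq
  have hne : cutoff s (e.coord q) ≠ 1 := fun h ↦ hq (by rw [h, sub_self, zero_mul])
  have hgt : s < ‖e.coord q‖ := not_le.1 fun h ↦ hne (cutoff_eq_one hs h)
  rw [e.mem_far_iff_coord]
  by_cases hqU : q ∈ e.U
  · exact ⟨hqU, hgt⟩
  · rw [e.coord_of_not_mem'' hqU, norm_zero] at hgt
    exact absurd hgt (not_lt.2 hs.le)

/-! ### The Sobolev inequality for the truncation to the end -/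

variable [IsManifold (𝓡 3) ∞ X] [T2Space X] [LocallyCompactSpace X] [MeasurableSpace X] [BorelSpace X]
  (D : InitialDataSet (𝓡 3) X) [D.metric.HasLeviCivita]

omit [T2Space X] [LocallyCompactSpace X] [MeasurableSpace X] [BorelSpace X] in
/-- **`‖Du‖² ≤ 2 h⁻¹(dζ, dζ) √(det h_{ij})` far out** (`u = ζ ∘ Φ`): at points of the end where
`|(h_{ij})⁻¹_{kl} √(det h_{ij}) − δ_{kl}| ≤ 1/6`, the Euclidean size of the gradient of the chart
representative is controlled by the Dirichlet integrand of `ζ` times the density (the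
"uniform equivalence with the Euclidean metric" of Schoen–Yau 1979, p. 63).
[cite: SchoenYauPMT1979, proof of Lemma 3.1 (p. 63)] -/
theorem norm_fderiv_endValue_sq_le (z : exteriorRegion e.R) {ζ : X → ℝ}
    (hζ : MDifferentiableAt (𝓡 3) 𝓘(ℝ, ℝ) ζ (e.dataChart z))
    (hW : ∀ k l, |(Matrix.of fun i j ↦ hCoeff e D z (EuclideanSpace.single i 1)
        (EuclideanSpace.single j 1) : Matrix (Fin 3) (Fin 3) ℝ)⁻¹ k l *
      Real.sqrt (Matrix.of fun i j ↦ hCoeff e D z (EuclideanSpace.single i 1)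
        (EuclideanSpace.single j 1) : Matrix (Fin 3) (Fin 3) ℝ).det -
      (1 : Matrix (Fin 3) (Fin 3) ℝ) k l| ≤ 1 / 6) :
    ‖fderiv ℝ (endValue e ζ) z‖ ^ 2 ≤
      2 * (D.metric.innerDual (e.dataChart z) (mvfderiv (𝓡 3) ζ (e.dataChart z)).toLinearMap
        (mvfderiv (𝓡 3) ζ (e.dataChart z)).toLinearMap *
        Real.sqrt (Matrix.of fun i j ↦ hCoeff e D z (EuclideanSpace.single i 1)
          (EuclideanSpace.single j 1) : Matrix (Fin 3) (Fin 3) ℝ).det) := by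
  rw [e.innerDual_mvfderiv_dataChart D z hζ hζ, Finset.sum_mul]
  simp_rw [Finset.sum_mul]
  set a : Fin 3 → ℝ := fun k ↦ fderiv ℝ (endValue e ζ) z (EuclideanSpace.single k 1) with ha
  have hq := quadForm_ge_half_sum_sq (W := Matrix.of fun k l ↦
    (Matrix.of fun i j ↦ hCoeff e D z (EuclideanSpace.single i 1) (EuclideanSpace.single j 1) :
      Matrix (Fin 3) (Fin 3) ℝ)⁻¹ k l *
    Real.sqrt (Matrix.of fun i j ↦ hCoeff e D z (EuclideanSpace.single i 1)
      (EuclideanSpace.single j 1) : Matrix (Fin 3) (Fin 3) ℝ).det)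
    (fun k l ↦ by simpa only [Matrix.of_apply] using hW k l) a
  simp only [Matrix.of_apply, ha] at hq
  have hn := norm_sq_le_sum_sq_apply (fderiv ℝ (endValue e ζ) z)
  have hre : ∀ l k, (Matrix.of fun i j ↦ hCoeff e D z (EuclideanSpace.single i 1)
      (EuclideanSpace.single j 1) : Matrix (Fin 3) (Fin 3) ℝ)⁻¹ k l *
      fderiv ℝ (endValue e ζ) z (EuclideanSpace.single k 1) *
      fderiv ℝ (endValue e ζ) z (EuclideanSpace.single l 1) *
      Real.sqrt (Matrix.of fun i j ↦ hCoeff e D z (EuclideanSpace.single i 1)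
        (EuclideanSpace.single j 1) : Matrix (Fin 3) (Fin 3) ℝ).det =
      (Matrix.of fun i j ↦ hCoeff e D z (EuclideanSpace.single i 1)
        (EuclideanSpace.single j 1) : Matrix (Fin 3) (Fin 3) ℝ)⁻¹ k l *
      Real.sqrt (Matrix.of fun i j ↦ hCoeff e D z (EuclideanSpace.single i 1)
        (EuclideanSpace.single j 1) : Matrix (Fin 3) (Fin 3) ℝ).det *
      fderiv ℝ (endValue e ζ) z (EuclideanSpace.single k 1) *
      fderiv ℝ (endValue e ζ) z (EuclideanSpace.single l 1) := fun l k ↦ by ring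
  simp_rw [hre]
  linarith

/-- **The Sobolev inequality for the truncation to the end** (Schoen–Yau 1979, proof of
Lemma 3.1, the inequality on `N_k`, p. 63). For data with an end `e` on which
`h − δ = O₂(r^{−α})`, `α > 0`, there are `s > R` and `C ≥ 0` such that for every `ζ ∈ C¹_c(X)`,
with `ζ₁ = (1 − χ_s ∘ coord) ζ` (`χ_s` the cut-off `cutoff s`: `ζ₁ = 0` where `‖coord‖ ≤ s`,
`ζ₁ = ζ` where `2s ≤ ‖coord‖`):
`∫_X ζ₁⁶ dV_h ≤ C (∫_X h⁻¹(dζ, dζ) dV_h)³`. Proof: read `ζ₁` in the chart of the end, where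
`dV_h = √(det h_{ij}) dz ≤ 7 dz` and `ζ₁ ∘ Φ = (1 − χ_s)(ζ ∘ Φ)`; apply the Euclidean estimate for
the truncation (`eLpNorm_six_cutoff_mul_le`: Hardy + Gagliardo–Nirenberg–Sobolev) to
`u = ζ ∘ Φ ∈ C¹({R < ‖z‖})`, which vanishes far out; and bound `‖Du‖² ≤ 2 h⁻¹(dζ,dζ) √(det h_{ij})`
(`norm_fderiv_endValue_sq_le`). [cite: SchoenYauPMT1979, proof of Lemma 3.1 (p. 63)] -/
theorem integral_endTruncation_pow_six_le {α : ℝ} (hα : 0 < α) (hAF : e.IsMetricAsymptoticallyFlat D α) :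
    ∃ s C : ℝ, e.R < s ∧ 0 ≤ C ∧ ∀ ζ : X → ℝ, ContMDiff (𝓡 3) 𝓘(ℝ, ℝ) 1 ζ → HasCompactSupport ζ →
      ∫ x, ((1 - cutoff s (e.coord x)) * ζ x) ^ 6 ∂riemannianMeasure D.h ≤
        C * (∫ x, D.metric.innerDual x (mvfderiv (𝓡 3) ζ x).toLinearMap
          (mvfderiv (𝓡 3) ζ x).toLinearMap ∂riemannianMeasure D.h) ^ 3 := by
  classical
  haveI : (PseudoRiemannianMetric.ofRiemannian D.h).HasLeviCivita := ‹D.metric.HasLeviCivita›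
  set μ : Measure X := riemannianMeasure D.h with hμ
  haveI : IsFiniteMeasureOnCompacts μ :=
    ⟨fun K hK ↦ riemannianVolume_lt_top_of_isCompact_holds D.h le_rfl hK⟩
  set H : E3 → Matrix (Fin 3) (Fin 3) ℝ := fun z ↦ Matrix.of fun i j ↦
    hCoeff e D z (EuclideanSpace.single i 1) (EuclideanSpace.single j 1) with hHdef
  -- the radii: ellipticity `|W − δ| ≤ 1/6`, density `≤ 7`
  obtain ⟨ρE, hρE⟩ := e.exists_radius_abs_gramInvSqrtDet_sub_one_le D hα hAF
    (by norm_num : (0 : ℝ) < 1 / 6)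
  obtain ⟨R₃, hdens⟩ := e.exists_radius_sqrt_det_hCoeff_le D hα hAF
  set s : ℝ := max (max ρE R₃) (e.R + 1) with hsdef
  have hRs : e.R < s := by
    have : e.R + 1 ≤ s := le_max_right _ _
    linarith
  have hs0 : 0 < s := e.R_pos.trans hRs
  have hρEs : ρE ≤ s := (le_max_left _ _).trans (le_max_left _ _)
  have hR₃s : R₃ ≤ s := (le_max_right _ _).trans (le_max_left _ _)
  -- the Euclidean constant
  obtain ⟨c, hc0, hc⟩ := eLpNorm_six_cutoff_mul_le (E := E3) finrank_euclideanSpace_fin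
  set K' : ℝ≥0∞ := SNormLESNormFDerivOfEqConst ℝ (volume : Measure E3) 2 * (1 + 4 * ENNReal.ofReal c)
    with hK'
  have hK't : K' ≠ ⊤ := ENNReal.mul_ne_top ENNReal.coe_ne_top
    (ENNReal.add_ne_top.2 ⟨ENNReal.one_ne_top, ENNReal.mul_ne_top (by norm_num) ENNReal.ofReal_ne_top⟩)
  refine ⟨s, 56 * K'.toReal ^ 6, hRs, by positivity, fun ζ hζ1 hζc ↦ ?_⟩
  -- notation
  set ζ₁ : X → ℝ := fun q ↦ (1 - cutoff s (e.coord q)) * ζ q with hζ₁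
  set u : E3 → ℝ := endValue e ζ with hu
  set U₁ : E3 → ℝ := fun y ↦ (1 - cutoff s y) * u y with hU₁
  set ID : X → ℝ := fun x ↦ D.metric.innerDual x (mvfderiv (𝓡 3) ζ x).toLinearMap
    (mvfderiv (𝓡 3) ζ x).toLinearMap with hID
  set S : Set E3 := {y | s < ‖y‖} with hS
  have hSo : IsOpen S := isOpen_lt continuous_const continuous_norm
  have hSm : MeasurableSet S := hSo.measurableSet
  -- (1) `u` is `C¹` on the exterior region and vanishes far out; the Euclidean estimate
  have hu1 : ContDiffOn ℝ 1 u {y | e.R < ‖y‖} := e.contDiffOn_endValue_of_contMDiff (n := 1) hζ1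
  obtain ⟨ρ, hρ⟩ := e.exists_radius_endValue_eq_zero hζc
  have hE := hc e.R_pos hRs hu1 hρ
  -- (2) the left-hand side in the chart
  have hζ₁c : Continuous ζ₁ :=
    ((contMDiff_const.sub (e.contMDiff_cutoff_coord hRs)).continuous).mul hζ1.continuous
  have hsupp : support (fun q ↦ ζ₁ q ^ 6) ⊆ e.far s := by
    intro q hq
    refine e.support_endTruncation_subset hs0 ζ ?_
    rw [mem_support] at hq ⊢
    intro h
    apply hq
    have h0 : ζ₁ q = 0 := h
    rw [h0, zero_pow (by norm_num)]
  have hLchart : ∫ x, ζ₁ x ^ 6 ∂μ =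
      ∫ z in S, U₁ z ^ 6 * Real.sqrt (H z).det := by
    rw [e.integral_eq_setIntegral_far D hRs.le hsupp]
    refine setIntegral_congr_fun hSm fun z hz ↦ ?_
    have hzR : e.R < ‖z‖ := hRs.trans hz
    simp only [hζ₁, hU₁, hu, hHdef, e.dataChartExt_of_lt hzR, e.coord_dataChart, endValue_of_lt e ζ hzR]
  -- (3) `∫_S U₁⁶ √det ≤ 7 ∫ U₁⁶`
  have hU₁1 : ContDiff ℝ 1 U₁ :=
    contDiff_cutoff_mul (contDiff_const.sub (contDiff_cutoff s)) hRs
      (fun y hy ↦ by simp only [cutoff_eq_one hs0 hy.le, sub_self]) hu1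
  have hU₁c : Continuous U₁ := hU₁1.continuous
  have hU₁cs : HasCompactSupport U₁ := hasCompactSupport_cutoff_mul hρ
  have hU₁6cs : HasCompactSupport fun y ↦ U₁ y ^ 6 := hU₁cs.mono fun y hy ↦ by
    rw [mem_support] at hy ⊢
    exact fun h ↦ hy (by simp [h])
  have hU₁6i : Integrable (fun y ↦ U₁ y ^ 6) (volume : Measure E3) :=
    (hU₁c.pow 6).integrable_of_hasCompactSupport hU₁6cs
  have hL1 : ∫ z in S, U₁ z ^ 6 * Real.sqrt (H z).det ≤ 7 * ∫ z, U₁ z ^ 6 := by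
    calc ∫ z in S, U₁ z ^ 6 * Real.sqrt (H z).det ≤ ∫ z in S, 7 * U₁ z ^ 6 := by
          refine integral_mono_of_nonneg ?_ ((hU₁6i.const_mul 7).integrableOn) ?_
          · exact Eventually.of_forall fun z ↦ mul_nonneg (by positivity) (Real.sqrt_nonneg _)
          · rw [EventuallyLE, ae_restrict_iff' hSm]
            refine Eventually.of_forall fun z hz ↦ ?_
            have h7 := hdens z (hR₃s.trans (le_of_lt hz))
            have h0 : 0 ≤ U₁ z ^ 6 := by positivity
            calc U₁ z ^ 6 * Real.sqrt (H z).det ≤ U₁ z ^ 6 * 7 := mul_le_mul_of_nonneg_left h7 h0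
              _ = 7 * U₁ z ^ 6 := by ring
      _ = 7 * ∫ z in S, U₁ z ^ 6 := integral_const_mul _ _
      _ ≤ 7 * ∫ z, U₁ z ^ 6 := by
          refine mul_le_mul_of_nonneg_left ?_ (by norm_num)
          exact setIntegral_le_integral hU₁6i (Eventually.of_forall fun z ↦ by positivity)
  -- (4) `∫ U₁⁶ = ‖U₁‖₆⁶ ≤ (K' ‖Du‖_{L²(S)})⁶ = K'⁶ J³`, `J = ∫_S ‖Du‖²`
  have hDuS : ContinuousOn (fun y ↦ ‖fderiv ℝ u y‖) S :=
    ((hu1.continuousOn_fderiv_of_isOpen (isOpen_lt continuous_const continuous_norm) le_rfl).mono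
      fun y hy ↦ hRs.trans hy).norm
  have hDuzero : ∀ y : E3, ρ < ‖y‖ → fderiv ℝ u y = 0 := by
    intro y hy
    have hev : u =ᶠ[𝓝 y] fun _ ↦ 0 := by
      filter_upwards [(isOpen_lt continuous_const continuous_norm).mem_nhds hy] with z hz
      exact hρ z hz.le
    rw [hev.fderiv_eq, fderiv_const_apply]
  have hKc : IsCompact {y : E3 | s ≤ ‖y‖ ∧ ‖y‖ ≤ max s ρ} := by
    have : {y : E3 | s ≤ ‖y‖ ∧ ‖y‖ ≤ max s ρ} = closedBall (0 : E3) (max s ρ) ∩ {y | s ≤ ‖y‖} := by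
      ext y
      simp only [mem_setOf_eq, mem_inter_iff, mem_closedBall_zero_iff]
      tauto
    rw [this]
    exact (isCompact_closedBall _ _).inter_right (isClosed_le continuous_const continuous_norm)
  have hKsub : {y : E3 | s ≤ ‖y‖ ∧ ‖y‖ ≤ max s ρ} ⊆ {y | e.R < ‖y‖} := fun y hy ↦
    hRs.trans_le hy.1
  have hDuSint : Integrable (fun y ↦ ‖fderiv ℝ u y‖ ^ 2) (volume.restrict S) := by
    have h1 : IntegrableOn (fun y ↦ ‖fderiv ℝ u y‖ ^ 2) {y : E3 | s ≤ ‖y‖ ∧ ‖y‖ ≤ max s ρ}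
        volume :=
      (((hu1.continuousOn_fderiv_of_isOpen (isOpen_lt continuous_const continuous_norm)
        le_rfl).norm.pow 2).mono hKsub).integrableOn_compact hKc
    have hs' : S ⊆ {y : E3 | s ≤ ‖y‖ ∧ ‖y‖ ≤ max s ρ} ∪ {y : E3 | max s ρ < ‖y‖} := by
      intro y hy
      by_cases h : ‖y‖ ≤ max s ρ
      · exact Or.inl ⟨le_of_lt hy, h⟩
      · exact Or.inr (not_le.1 h)
    refine IntegrableOn.mono_set (h1.union ?_) hs'
    refine (integrableOn_zero).congr_fun (fun y hy ↦ ?_)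
      (isOpen_lt continuous_const continuous_norm).measurableSet
    have hyρ : ρ < ‖y‖ := (le_max_right _ _).trans_lt hy
    simp [hDuzero y hyρ]
  set J : ℝ := ∫ y in S, ‖fderiv ℝ u y‖ ^ 2 with hJ
  have hJ0 : 0 ≤ J := integral_nonneg fun _ ↦ by positivity
  have hDuL2 : eLpNorm (fderiv ℝ u) 2 (volume.restrict S) = ENNReal.ofReal (Real.sqrt J) := by
    rw [← eLpNorm_norm]
    exact eLpNorm_two_eq_ofReal_sqrt (hDuS.aestronglyMeasurable hSm) hDuSint
  have hI6 : ∫ y, U₁ y ^ 6 = (eLpNorm U₁ 6 (volume : Measure E3)).toReal ^ 6 := by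
    have hmem : MemLp U₁ 6 (volume : Measure E3) := hU₁c.memLp_of_hasCompactSupport hU₁cs
    rw [hmem.eLpNorm_eq_integral_rpow_norm (by norm_num) (by norm_num)]
    have h6 : (6 : ℝ≥0∞).toReal = 6 := by norm_num
    rw [h6]
    have hint6 : ∫ y, ‖U₁ y‖ ^ (6 : ℝ) = ∫ y, U₁ y ^ 6 := by
      refine integral_congr_ae (Eventually.of_forall fun y ↦ ?_)
      simp only [Real.norm_eq_abs]
      rw [show (6 : ℝ) = ((6 : ℕ) : ℝ) by norm_num, Real.rpow_natCast, Even.pow_abs (by decide)]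
    rw [hint6]
    have hI0 : 0 ≤ ∫ y, U₁ y ^ 6 := integral_nonneg fun _ ↦ by positivity
    rw [ENNReal.toReal_ofReal (Real.rpow_nonneg hI0 _)]
    rw [show ((6 : ℝ)⁻¹) = ((6 : ℕ) : ℝ)⁻¹ by norm_num, Real.rpow_inv_natCast_pow hI0 (by norm_num)]
  have hI6le : ∫ y, U₁ y ^ 6 ≤ K'.toReal ^ 6 * J ^ 3 := by
    rw [hI6]
    have h1 : (eLpNorm U₁ 6 (volume : Measure E3)).toReal ≤ K'.toReal * Real.sqrt J := by
      have hfin : K' * eLpNorm (fderiv ℝ u) 2 (volume.restrict S) ≠ ⊤ := by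
        rw [hDuL2]
        exact ENNReal.mul_ne_top hK't ENNReal.ofReal_ne_top
      have h := ENNReal.toReal_mono hfin hE
      rwa [ENNReal.toReal_mul, hDuL2, ENNReal.toReal_ofReal (Real.sqrt_nonneg _)] at h
    have h0 : 0 ≤ (eLpNorm U₁ 6 (volume : Measure E3)).toReal := ENNReal.toReal_nonneg
    calc (eLpNorm U₁ 6 (volume : Measure E3)).toReal ^ 6 ≤ (K'.toReal * Real.sqrt J) ^ 6 :=
          pow_le_pow_left₀ h0 h1 6
      _ = K'.toReal ^ 6 * J ^ 3 := by
          rw [mul_pow, show (6 : ℕ) = 2 * 3 by norm_num, pow_mul (Real.sqrt J), Real.sq_sqrt hJ0]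
  -- (5) `J ≤ 2 ∫_X h⁻¹(dζ, dζ) dV`
  have hIDc : Continuous ID := continuous_innerDual_mvfderiv D.metric hζ1 hζ1
  have hID0 : ∀ x, 0 ≤ ID x := fun x ↦ innerDual_self_nonneg D.h x _
  have hIDcs : HasCompactSupport ID := by
    refine HasCompactSupport.intro hζc fun x hx ↦ ?_
    have hev : ζ =ᶠ[𝓝 x] fun _ ↦ 0 := notMem_tsupport_iff_eventuallyEq.1 hx
    simp only [hID, PseudoRiemannianMetric.mvfderiv_eq_zero_of_eventuallyEq_zero hev,
      ContinuousLinearMap.toLinearMap_zero, PseudoRiemannianMetric.innerDual, LinearMap.zero_apply]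
  have hIDi : Integrable ID μ := hIDc.integrable_of_hasCompactSupport hIDcs
  have hI0 : 0 ≤ ∫ x, ID x ∂μ := integral_nonneg hID0
  have hJle : J ≤ 2 * ∫ x, ID x ∂μ := by
    -- pointwise in the chart: `‖Du‖² ≤ 2 ID(Φ z) √det`
    have hpt : ∀ z ∈ S, ‖fderiv ℝ u z‖ ^ 2 ≤ 2 * ID (e.dataChartExt z) * Real.sqrt (H z).det := by
      intro z hz
      have hzR : e.R < ‖z‖ := hRs.trans hz
      have hmd : MDifferentiableAt (𝓡 3) 𝓘(ℝ, ℝ) ζ (e.dataChart ⟨z, hzR⟩) :=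
        hζ1.mdifferentiableAt one_ne_zero
      have h := e.norm_fderiv_endValue_sq_le D ⟨z, hzR⟩ hmd (hρE z (hρEs.trans (le_of_lt hz)))
      rw [e.dataChartExt_of_lt hzR, mul_assoc]
      exact h
    -- in `ℝ≥0∞`
    have h1 : ENNReal.ofReal J = ∫⁻ z in S, ENNReal.ofReal (‖fderiv ℝ u z‖ ^ 2) :=
      ofReal_integral_eq_lintegral_ofReal hDuSint (Eventually.of_forall fun _ ↦ by positivity)
    have h2 : ∫⁻ z in S, ENNReal.ofReal (‖fderiv ℝ u z‖ ^ 2) ≤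
        ∫⁻ z in S, ENNReal.ofReal (2 * ID (e.dataChartExt z)) * ENNReal.ofReal (Real.sqrt (H z).det) := by
      refine setLIntegral_mono' hSm fun z hz ↦ ?_
      rw [← ENNReal.ofReal_mul (show (0 : ℝ) ≤ 2 * ID (e.dataChartExt z) by linarith [hID0 (e.dataChartExt z)])]
      exact ENNReal.ofReal_le_ofReal (hpt z hz)
    have h3 : ∫⁻ z in S, ENNReal.ofReal (2 * ID (e.dataChartExt z)) * ENNReal.ofReal (Real.sqrt (H z).det) =
        ∫⁻ p in e.far s, ENNReal.ofReal (2 * ID p) ∂μ :=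
      (e.setLIntegral_far D (fun p ↦ ENNReal.ofReal (2 * ID p)) hRs.le).symm
    have h4 : ∫⁻ p in e.far s, ENNReal.ofReal (2 * ID p) ∂μ ≤ ∫⁻ p, ENNReal.ofReal (2 * ID p) ∂μ :=
      setLIntegral_le_lintegral _ _
    have h5 : ∫⁻ p, ENNReal.ofReal (2 * ID p) ∂μ = ENNReal.ofReal (∫ p, 2 * ID p ∂μ) :=
      (ofReal_integral_eq_lintegral_ofReal (hIDi.const_mul 2)
        (Eventually.of_forall fun p ↦ show (0 : ℝ) ≤ 2 * ID p by linarith [hID0 p])).symm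
    have h6 : ENNReal.ofReal J ≤ ENNReal.ofReal (2 * ∫ x, ID x ∂μ) := by
      rw [h1, ← integral_const_mul, ← h5]
      exact h2.trans (h3.le.trans h4)
    exact (ENNReal.ofReal_le_ofReal_iff (by linarith)).1 h6
  -- (6) assemble
  have hfinal : ∫ x, ζ₁ x ^ 6 ∂μ ≤ 56 * K'.toReal ^ 6 * (∫ x, ID x ∂μ) ^ 3 := by
    calc ∫ x, ζ₁ x ^ 6 ∂μ = ∫ z in S, U₁ z ^ 6 * Real.sqrt (H z).det := hLchart
      _ ≤ 7 * ∫ z, U₁ z ^ 6 := hL1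
      _ ≤ 7 * (K'.toReal ^ 6 * J ^ 3) := mul_le_mul_of_nonneg_left hI6le (by norm_num)
      _ ≤ 7 * (K'.toReal ^ 6 * (2 * ∫ x, ID x ∂μ) ^ 3) := by
          gcongr
      _ = 56 * K'.toReal ^ 6 * (∫ x, ID x ∂μ) ^ 3 := by ring
  exact hfinal

/-- **The Sobolev inequality for the truncation to the end, uniformly in the truncation radius**:
the estimate of `integral_endTruncation_pow_six_le` holds with one constant `C` for every
truncation radius `s ≥ s₀` (the proof only uses that beyond `s` the density is `≤ 7` and the
inverse metric is `1/6`-close to `δ`). This is the form combined with the core estimate in the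
proof of Schoen–Yau's Lemma 3.1. [cite: SchoenYauPMT1979, proof of Lemma 3.1 (p. 63)] -/
theorem integral_endTruncation_pow_six_le_of_le {α : ℝ} (hα : 0 < α)
    (hAF : e.IsMetricAsymptoticallyFlat D α) :
    ∃ s₀ C : ℝ, e.R < s₀ ∧ 0 ≤ C ∧ ∀ s : ℝ, s₀ ≤ s → ∀ ζ : X → ℝ, ContMDiff (𝓡 3) 𝓘(ℝ, ℝ) 1 ζ →
      HasCompactSupport ζ →
      ∫ x, ((1 - cutoff s (e.coord x)) * ζ x) ^ 6 ∂riemannianMeasure D.h ≤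
        C * (∫ x, D.metric.innerDual x (mvfderiv (𝓡 3) ζ x).toLinearMap
          (mvfderiv (𝓡 3) ζ x).toLinearMap ∂riemannianMeasure D.h) ^ 3 := by
  classical
  haveI : (PseudoRiemannianMetric.ofRiemannian D.h).HasLeviCivita := ‹D.metric.HasLeviCivita›
  set μ : Measure X := riemannianMeasure D.h with hμ
  haveI : IsFiniteMeasureOnCompacts μ :=
    ⟨fun K hK ↦ riemannianVolume_lt_top_of_isCompact_holds D.h le_rfl hK⟩
  set H : E3 → Matrix (Fin 3) (Fin 3) ℝ := fun z ↦ Matrix.of fun i j ↦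
    hCoeff e D z (EuclideanSpace.single i 1) (EuclideanSpace.single j 1) with hHdef
  -- the radii: ellipticity `|W − δ| ≤ 1/6`, density `≤ 7`
  obtain ⟨ρE, hρE⟩ := e.exists_radius_abs_gramInvSqrtDet_sub_one_le D hα hAF
    (by norm_num : (0 : ℝ) < 1 / 6)
  obtain ⟨R₃, hdens⟩ := e.exists_radius_sqrt_det_hCoeff_le D hα hAF
  set s₀ : ℝ := max (max ρE R₃) (e.R + 1) with hs₀def
  have hRs₀ : e.R < s₀ := by
    have : e.R + 1 ≤ s₀ := le_max_right _ _
    linarith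
  -- the Euclidean constant
  obtain ⟨c, hc0, hc⟩ := eLpNorm_six_cutoff_mul_le (E := E3) finrank_euclideanSpace_fin
  set K' : ℝ≥0∞ := SNormLESNormFDerivOfEqConst ℝ (volume : Measure E3) 2 * (1 + 4 * ENNReal.ofReal c)
    with hK'
  have hK't : K' ≠ ⊤ := ENNReal.mul_ne_top ENNReal.coe_ne_top
    (ENNReal.add_ne_top.2 ⟨ENNReal.one_ne_top, ENNReal.mul_ne_top (by norm_num) ENNReal.ofReal_ne_top⟩)
  refine ⟨s₀, 56 * K'.toReal ^ 6, hRs₀, by positivity, fun s hs₀s ζ hζ1 hζc ↦ ?_⟩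
  have hRs : e.R < s := hRs₀.trans_le hs₀s
  have hs0 : 0 < s := e.R_pos.trans hRs
  have hρEs : ρE ≤ s := ((le_max_left _ _).trans (le_max_left _ _)).trans hs₀s
  have hR₃s : R₃ ≤ s := ((le_max_right _ _).trans (le_max_left _ _)).trans hs₀s
  -- notation
  set ζ₁ : X → ℝ := fun q ↦ (1 - cutoff s (e.coord q)) * ζ q with hζ₁
  set u : E3 → ℝ := endValue e ζ with hu
  set U₁ : E3 → ℝ := fun y ↦ (1 - cutoff s y) * u y with hU₁
  set ID : X → ℝ := fun x ↦ D.metric.innerDual x (mvfderiv (𝓡 3) ζ x).toLinearMap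
    (mvfderiv (𝓡 3) ζ x).toLinearMap with hID
  set S : Set E3 := {y | s < ‖y‖} with hS
  have hSo : IsOpen S := isOpen_lt continuous_const continuous_norm
  have hSm : MeasurableSet S := hSo.measurableSet
  -- (1) `u` is `C¹` on the exterior region and vanishes far out; the Euclidean estimate
  have hu1 : ContDiffOn ℝ 1 u {y | e.R < ‖y‖} := e.contDiffOn_endValue_of_contMDiff (n := 1) hζ1
  obtain ⟨ρ, hρ⟩ := e.exists_radius_endValue_eq_zero hζc
  have hE := hc e.R_pos hRs hu1 hρ
  -- (2) the left-hand side in the chart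
  have hζ₁c : Continuous ζ₁ :=
    ((contMDiff_const.sub (e.contMDiff_cutoff_coord hRs)).continuous).mul hζ1.continuous
  have hsupp : support (fun q ↦ ζ₁ q ^ 6) ⊆ e.far s := by
    intro q hq
    refine e.support_endTruncation_subset hs0 ζ ?_
    rw [mem_support] at hq ⊢
    intro h
    apply hq
    have h0 : ζ₁ q = 0 := h
    rw [h0, zero_pow (by norm_num)]
  have hLchart : ∫ x, ζ₁ x ^ 6 ∂μ =
      ∫ z in S, U₁ z ^ 6 * Real.sqrt (H z).det := by
    rw [e.integral_eq_setIntegral_far D hRs.le hsupp]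
    refine setIntegral_congr_fun hSm fun z hz ↦ ?_
    have hzR : e.R < ‖z‖ := hRs.trans hz
    simp only [hζ₁, hU₁, hu, hHdef, e.dataChartExt_of_lt hzR, e.coord_dataChart, endValue_of_lt e ζ hzR]
  -- (3) `∫_S U₁⁶ √det ≤ 7 ∫ U₁⁶`
  have hU₁1 : ContDiff ℝ 1 U₁ :=
    contDiff_cutoff_mul (contDiff_const.sub (contDiff_cutoff s)) hRs
      (fun y hy ↦ by simp only [cutoff_eq_one hs0 hy.le, sub_self]) hu1
  have hU₁c : Continuous U₁ := hU₁1.continuous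
  have hU₁cs : HasCompactSupport U₁ := hasCompactSupport_cutoff_mul hρ
  have hU₁6cs : HasCompactSupport fun y ↦ U₁ y ^ 6 := hU₁cs.mono fun y hy ↦ by
    rw [mem_support] at hy ⊢
    exact fun h ↦ hy (by simp [h])
  have hU₁6i : Integrable (fun y ↦ U₁ y ^ 6) (volume : Measure E3) :=
    (hU₁c.pow 6).integrable_of_hasCompactSupport hU₁6cs
  have hL1 : ∫ z in S, U₁ z ^ 6 * Real.sqrt (H z).det ≤ 7 * ∫ z, U₁ z ^ 6 := by
    calc ∫ z in S, U₁ z ^ 6 * Real.sqrt (H z).det ≤ ∫ z in S, 7 * U₁ z ^ 6 := by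
          refine integral_mono_of_nonneg ?_ ((hU₁6i.const_mul 7).integrableOn) ?_
          · exact Eventually.of_forall fun z ↦ mul_nonneg (by positivity) (Real.sqrt_nonneg _)
          · rw [EventuallyLE, ae_restrict_iff' hSm]
            refine Eventually.of_forall fun z hz ↦ ?_
            have h7 := hdens z (hR₃s.trans (le_of_lt hz))
            have h0 : 0 ≤ U₁ z ^ 6 := by positivity
            calc U₁ z ^ 6 * Real.sqrt (H z).det ≤ U₁ z ^ 6 * 7 := mul_le_mul_of_nonneg_left h7 h0
              _ = 7 * U₁ z ^ 6 := by ring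
      _ = 7 * ∫ z in S, U₁ z ^ 6 := integral_const_mul _ _
      _ ≤ 7 * ∫ z, U₁ z ^ 6 := by
          refine mul_le_mul_of_nonneg_left ?_ (by norm_num)
          exact setIntegral_le_integral hU₁6i (Eventually.of_forall fun z ↦ by positivity)
  -- (4) `∫ U₁⁶ = ‖U₁‖₆⁶ ≤ (K' ‖Du‖_{L²(S)})⁶ = K'⁶ J³`, `J = ∫_S ‖Du‖²`
  have hDuS : ContinuousOn (fun y ↦ ‖fderiv ℝ u y‖) S :=
    ((hu1.continuousOn_fderiv_of_isOpen (isOpen_lt continuous_const continuous_norm) le_rfl).mono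
      fun y hy ↦ hRs.trans hy).norm
  have hDuzero : ∀ y : E3, ρ < ‖y‖ → fderiv ℝ u y = 0 := by
    intro y hy
    have hev : u =ᶠ[𝓝 y] fun _ ↦ 0 := by
      filter_upwards [(isOpen_lt continuous_const continuous_norm).mem_nhds hy] with z hz
      exact hρ z hz.le
    rw [hev.fderiv_eq, fderiv_const_apply]
  have hKc : IsCompact {y : E3 | s ≤ ‖y‖ ∧ ‖y‖ ≤ max s ρ} := by
    have : {y : E3 | s ≤ ‖y‖ ∧ ‖y‖ ≤ max s ρ} = closedBall (0 : E3) (max s ρ) ∩ {y | s ≤ ‖y‖} := by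
      ext y
      simp only [mem_setOf_eq, mem_inter_iff, mem_closedBall_zero_iff]
      tauto
    rw [this]
    exact (isCompact_closedBall _ _).inter_right (isClosed_le continuous_const continuous_norm)
  have hKsub : {y : E3 | s ≤ ‖y‖ ∧ ‖y‖ ≤ max s ρ} ⊆ {y | e.R < ‖y‖} := fun y hy ↦
    hRs.trans_le hy.1
  have hDuSint : Integrable (fun y ↦ ‖fderiv ℝ u y‖ ^ 2) (volume.restrict S) := by
    have h1 : IntegrableOn (fun y ↦ ‖fderiv ℝ u y‖ ^ 2) {y : E3 | s ≤ ‖y‖ ∧ ‖y‖ ≤ max s ρ}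
        volume :=
      (((hu1.continuousOn_fderiv_of_isOpen (isOpen_lt continuous_const continuous_norm)
        le_rfl).norm.pow 2).mono hKsub).integrableOn_compact hKc
    have hs' : S ⊆ {y : E3 | s ≤ ‖y‖ ∧ ‖y‖ ≤ max s ρ} ∪ {y : E3 | max s ρ < ‖y‖} := by
      intro y hy
      by_cases h : ‖y‖ ≤ max s ρ
      · exact Or.inl ⟨le_of_lt hy, h⟩
      · exact Or.inr (not_le.1 h)
    refine IntegrableOn.mono_set (h1.union ?_) hs'
    refine (integrableOn_zero).congr_fun (fun y hy ↦ ?_)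
      (isOpen_lt continuous_const continuous_norm).measurableSet
    have hyρ : ρ < ‖y‖ := (le_max_right _ _).trans_lt hy
    simp [hDuzero y hyρ]
  set J : ℝ := ∫ y in S, ‖fderiv ℝ u y‖ ^ 2 with hJ
  have hJ0 : 0 ≤ J := integral_nonneg fun _ ↦ by positivity
  have hDuL2 : eLpNorm (fderiv ℝ u) 2 (volume.restrict S) = ENNReal.ofReal (Real.sqrt J) := by
    rw [← eLpNorm_norm]
    exact eLpNorm_two_eq_ofReal_sqrt (hDuS.aestronglyMeasurable hSm) hDuSint
  have hI6 : ∫ y, U₁ y ^ 6 = (eLpNorm U₁ 6 (volume : Measure E3)).toReal ^ 6 := by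
    have hmem : MemLp U₁ 6 (volume : Measure E3) := hU₁c.memLp_of_hasCompactSupport hU₁cs
    rw [hmem.eLpNorm_eq_integral_rpow_norm (by norm_num) (by norm_num)]
    have h6 : (6 : ℝ≥0∞).toReal = 6 := by norm_num
    rw [h6]
    have hint6 : ∫ y, ‖U₁ y‖ ^ (6 : ℝ) = ∫ y, U₁ y ^ 6 := by
      refine integral_congr_ae (Eventually.of_forall fun y ↦ ?_)
      simp only [Real.norm_eq_abs]
      rw [show (6 : ℝ) = ((6 : ℕ) : ℝ) by norm_num, Real.rpow_natCast, Even.pow_abs (by decide)]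
    rw [hint6]
    have hI0 : 0 ≤ ∫ y, U₁ y ^ 6 := integral_nonneg fun _ ↦ by positivity
    rw [ENNReal.toReal_ofReal (Real.rpow_nonneg hI0 _)]
    rw [show ((6 : ℝ)⁻¹) = ((6 : ℕ) : ℝ)⁻¹ by norm_num, Real.rpow_inv_natCast_pow hI0 (by norm_num)]
  have hI6le : ∫ y, U₁ y ^ 6 ≤ K'.toReal ^ 6 * J ^ 3 := by
    rw [hI6]
    have h1 : (eLpNorm U₁ 6 (volume : Measure E3)).toReal ≤ K'.toReal * Real.sqrt J := by
      have hfin : K' * eLpNorm (fderiv ℝ u) 2 (volume.restrict S) ≠ ⊤ := by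
        rw [hDuL2]
        exact ENNReal.mul_ne_top hK't ENNReal.ofReal_ne_top
      have h := ENNReal.toReal_mono hfin hE
      rwa [ENNReal.toReal_mul, hDuL2, ENNReal.toReal_ofReal (Real.sqrt_nonneg _)] at h
    have h0 : 0 ≤ (eLpNorm U₁ 6 (volume : Measure E3)).toReal := ENNReal.toReal_nonneg
    calc (eLpNorm U₁ 6 (volume : Measure E3)).toReal ^ 6 ≤ (K'.toReal * Real.sqrt J) ^ 6 :=
          pow_le_pow_left₀ h0 h1 6
      _ = K'.toReal ^ 6 * J ^ 3 := by
          rw [mul_pow, show (6 : ℕ) = 2 * 3 by norm_num, pow_mul (Real.sqrt J), Real.sq_sqrt hJ0]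
  -- (5) `J ≤ 2 ∫_X h⁻¹(dζ, dζ) dV`
  have hIDc : Continuous ID := continuous_innerDual_mvfderiv D.metric hζ1 hζ1
  have hID0 : ∀ x, 0 ≤ ID x := fun x ↦ innerDual_self_nonneg D.h x _
  have hIDcs : HasCompactSupport ID := by
    refine HasCompactSupport.intro hζc fun x hx ↦ ?_
    have hev : ζ =ᶠ[𝓝 x] fun _ ↦ 0 := notMem_tsupport_iff_eventuallyEq.1 hx
    simp only [hID, PseudoRiemannianMetric.mvfderiv_eq_zero_of_eventuallyEq_zero hev,
      ContinuousLinearMap.toLinearMap_zero, PseudoRiemannianMetric.innerDual, LinearMap.zero_apply]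
  have hIDi : Integrable ID μ := hIDc.integrable_of_hasCompactSupport hIDcs
  have hI0 : 0 ≤ ∫ x, ID x ∂μ := integral_nonneg hID0
  have hJle : J ≤ 2 * ∫ x, ID x ∂μ := by
    -- pointwise in the chart: `‖Du‖² ≤ 2 ID(Φ z) √det`
    have hpt : ∀ z ∈ S, ‖fderiv ℝ u z‖ ^ 2 ≤ 2 * ID (e.dataChartExt z) * Real.sqrt (H z).det := by
      intro z hz
      have hzR : e.R < ‖z‖ := hRs.trans hz
      have hmd : MDifferentiableAt (𝓡 3) 𝓘(ℝ, ℝ) ζ (e.dataChart ⟨z, hzR⟩) :=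
        hζ1.mdifferentiableAt one_ne_zero
      have h := e.norm_fderiv_endValue_sq_le D ⟨z, hzR⟩ hmd (hρE z (hρEs.trans (le_of_lt hz)))
      rw [e.dataChartExt_of_lt hzR, mul_assoc]
      exact h
    -- in `ℝ≥0∞`
    have h1 : ENNReal.ofReal J = ∫⁻ z in S, ENNReal.ofReal (‖fderiv ℝ u z‖ ^ 2) :=
      ofReal_integral_eq_lintegral_ofReal hDuSint (Eventually.of_forall fun _ ↦ by positivity)
    have h2 : ∫⁻ z in S, ENNReal.ofReal (‖fderiv ℝ u z‖ ^ 2) ≤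
        ∫⁻ z in S, ENNReal.ofReal (2 * ID (e.dataChartExt z)) * ENNReal.ofReal (Real.sqrt (H z).det) := by
      refine setLIntegral_mono' hSm fun z hz ↦ ?_
      rw [← ENNReal.ofReal_mul (show (0 : ℝ) ≤ 2 * ID (e.dataChartExt z) by linarith [hID0 (e.dataChartExt z)])]
      exact ENNReal.ofReal_le_ofReal (hpt z hz)
    have h3 : ∫⁻ z in S, ENNReal.ofReal (2 * ID (e.dataChartExt z)) * ENNReal.ofReal (Real.sqrt (H z).det) =
        ∫⁻ p in e.far s, ENNReal.ofReal (2 * ID p) ∂μ :=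
      (e.setLIntegral_far D (fun p ↦ ENNReal.ofReal (2 * ID p)) hRs.le).symm
    have h4 : ∫⁻ p in e.far s, ENNReal.ofReal (2 * ID p) ∂μ ≤ ∫⁻ p, ENNReal.ofReal (2 * ID p) ∂μ :=
      setLIntegral_le_lintegral _ _
    have h5 : ∫⁻ p, ENNReal.ofReal (2 * ID p) ∂μ = ENNReal.ofReal (∫ p, 2 * ID p ∂μ) :=
      (ofReal_integral_eq_lintegral_ofReal (hIDi.const_mul 2)
        (Eventually.of_forall fun p ↦ show (0 : ℝ) ≤ 2 * ID p by linarith [hID0 p])).symm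
    have h6 : ENNReal.ofReal J ≤ ENNReal.ofReal (2 * ∫ x, ID x ∂μ) := by
      rw [h1, ← integral_const_mul, ← h5]
      exact h2.trans (h3.le.trans h4)
    exact (ENNReal.ofReal_le_ofReal_iff (by linarith)).1 h6
  -- (6) assemble
  have hfinal : ∫ x, ζ₁ x ^ 6 ∂μ ≤ 56 * K'.toReal ^ 6 * (∫ x, ID x ∂μ) ^ 3 := by
    calc ∫ x, ζ₁ x ^ 6 ∂μ = ∫ z in S, U₁ z ^ 6 * Real.sqrt (H z).det := hLchart
      _ ≤ 7 * ∫ z, U₁ z ^ 6 := hL1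
      _ ≤ 7 * (K'.toReal ^ 6 * J ^ 3) := mul_le_mul_of_nonneg_left hI6le (by norm_num)
      _ ≤ 7 * (K'.toReal ^ 6 * (2 * ∫ x, ID x ∂μ) ^ 3) := by
          gcongr
      _ = 56 * K'.toReal ^ 6 * (∫ x, ID x ∂μ) ^ 3 := by ring
  exact hfinal

end AFEnd

end Literature.Geometry.Lorentzian

end
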